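import Mathlib
import HarnessLib
import Literature.NumberTheory.Automorphic.GL2AdelicWeightVectors

/-!
# Glue stub, auxiliary file 1: the EVEN `SO(2)`-ladder — a weight-zero vector from an even `K`-type
(crux stmt-Langlands-15898 `QuarterDeficit1951.CorrespondentFingerprint`, line `Sketch`, stub
`stub_glue`; helper `--supports`)

The even twin of `GL2Real.exists_isWeightVec_one_lowerFun_eq_zero(_of_finite)`
(`Literature/NumberTheory/Automorphic/GL2WeightVectors.lean`): in a space `W₁` of archimedean-smooth
functions on a group `G` (along `ι : GL₂(ℝ) → G`), stable under the Lie derivatives along `GL₂(ℝ)`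
and under `r(ε)`, on which the Casimir operator `Ω` acts by a scalar `c` with
`2c - m² + 2m ≠ 0` for every EVEN integer `m` (for the Harish-Chandra parameter `{a, -a}`,
`a ∈ ℤ`, `c = 2a² - 1/2` and `2c - m² + 2m = 4a² - (m - 1)²`, odd minus even), a non-zero vector
of even weight `m` produces a non-zero vector of weight `0`: `X̄ X = 2c - m² + 2m ≠ 0` on weight
`m` (`raiseFun_lowerFun_of_isWeightVec`), so the lowering operator is injective on the even weights
and `X^{m/2} v ≠ 0` has weight `0` (for `m < 0` first apply `r(ε)`).  With the parity lemma
(`-1 = k_π` acting by `+1` forces the weight of a weight vector to be even) this gives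
`exists_isWeightVec_zero_of_finite_of_even`, the vector-level form of "`π_∞` is a weight-zero
principal series" used by the glue stub. [References: Bump1997 §2.5, Prop. 2.2.5, Exercise 2.1.7;
JacquetLanglands1970 Thm. 5.11; Gelbart1997 Remark 2.5.5.]
-/

set_option linter.dupNamespace false

noncomputable section

open scoped MatrixGroups Matrix
open Literature.NumberTheory.Automorphic Literature.NumberTheory.Automorphic.GL2Real

namespace Summit.Langlands.Langlands.Theorems.CorrespondentFingerprint

variable {G : Type*} [Group G] {ι : (RealMatrixGroup.gl ℝ (Fin 2)).carrier →* G}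

/-- `r(ε)` is injective on functions (`ε² = 1`). [folklore] -/
theorem eq_zero_of_archTranslate_epsK_eq_zero (φ : G → ℂ) (h : archTranslate ι epsK φ = 0) :
    φ = 0 := by
  have h2 : archTranslate ι epsK (archTranslate ι epsK φ) = φ := by
    rw [← Module.End.mul_apply, ← map_mul, epsK_mul_epsK, map_one, Module.End.one_apply]
  rw [← h2, h, map_zero]

/-- **The even ladder.**  Let `W₁` be a space of archimedean-smooth functions on `G`, stable under
the Lie derivatives along `GL₂(ℝ)` and under `r(ε)`, on which `Ω` acts by the scalar `c` with
`2c - (2k)² + 2(2k) ≠ 0` for all `k ∈ ℤ`.  A non-zero vector of even weight `2k` in `W₁` yields a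
non-zero vector of weight `0` in `W₁` (`X̄ X v = (2c - m² + 2m) v ≠ 0`, so `X v ≠ 0` has weight
`m - 2`; induct down to `0`, after `r(ε)` if `k < 0`). [cite: Bump1997, Prop. 2.2.5 and Exercise 2.1.7] -/
theorem exists_isWeightVec_zero_of_even {W₁ : Submodule ℂ (G → ℂ)}
    (hsmooth : ∀ φ ∈ W₁, IsArchSmooth ι φ)
    (heps : ∀ φ ∈ W₁, archTranslate ι epsK φ ∈ W₁)
    (hlie : ∀ (X : Matrix (Fin 2) (Fin 2) ℝ), ∀ φ ∈ W₁, lieDeriv ι (toLie X) φ ∈ W₁)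
    {c : ℂ} (hcas : ∀ φ ∈ W₁, casimirFun ι φ = c • φ)
    (hc : ∀ k : ℤ, 2 * c - (2 * (k : ℂ)) ^ 2 + 2 * (2 * (k : ℂ)) ≠ 0)
    {k : ℤ} {v : G → ℂ} (hvW : v ∈ W₁) (hv0 : v ≠ 0) (hv : IsWeightVec ι (2 * k) v) :
    ∃ ψ ∈ W₁, ψ ≠ 0 ∧ IsWeightVec ι 0 ψ := by
  have hlow : ∀ φ ∈ W₁, lowerFun ι φ ∈ W₁ := fun φ hφ =>
    W₁.sub_mem (hlie _ φ hφ) (W₁.smul_mem _ (W₁.add_mem (hlie _ φ hφ) (hlie _ φ hφ)))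
  -- the non-negative case, by induction on `j`, weight `2j`
  have pos : ∀ (j : ℕ) (u : G → ℂ), u ∈ W₁ → u ≠ 0 → IsWeightVec ι (2 * (j : ℤ)) u →
      ∃ ψ ∈ W₁, ψ ≠ 0 ∧ IsWeightVec ι 0 ψ := by
    intro j
    induction j with
    | zero =>
      intro u huW hu0 hu
      simp only [Nat.cast_zero, mul_zero] at hu
      exact ⟨u, huW, hu0, hu⟩
    | succ j ih =>
      intro u huW hu0 hu
      have hwW := hlow u huW
      have hww : IsWeightVec ι (2 * (j : ℤ)) (lowerFun ι u) := by
        have h := hu.weight_lowerFun (hsmooth u huW)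
        push_cast at h ⊢
        convert h using 2
        ring
      have hw0 : lowerFun ι u ≠ 0 := by
        intro h0
        have hRL := raiseFun_lowerFun_of_isWeightVec (hsmooth u huW) hu (hcas u huW)
        rw [h0, raiseFun_zero] at hRL
        rcases smul_eq_zero.1 hRL.symm with hc0 | hu00
        · apply hc ((j : ℤ) + 1)
          push_cast at hc0 ⊢
          linear_combination hc0
        · exact hu0 hu00
      exact ih (lowerFun ι u) hwW hw0 hww
  rcases le_or_gt 0 k with hk | hk
  · lift k to ℕ using hk
    exact pos k v hvW hv0 hv
  · -- negative weight: apply `r(ε)`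
    have hv' := hv.archTranslate_epsK
    have hk' : -(2 * k) = 2 * (-k) := by ring
    rw [hk'] at hv'
    obtain ⟨j, hj⟩ : ∃ j : ℕ, (j : ℤ) = -k := ⟨(-k).toNat, Int.toNat_of_nonneg (by omega)⟩
    rw [← hj] at hv'
    exact pos j _ (heps v hvW) (fun h => hv0 (eq_zero_of_archTranslate_epsK_eq_zero v h)) hv'

/-- **Parity, even case**: if `-1 = k_π` acts trivially on a non-zero function of weight `m`, then
`m` is even (`(-1)^m = 1`). [cite: Gelbart1997, Concluding Remark (1)] -/
theorem even_of_isWeightVec_of_rotK_pi {m : ℤ} {φ : G → ℂ} (hφ : IsWeightVec ι m φ)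
    (hpos : ∀ g, φ (g * ι (rotK Real.pi)) = φ g) (h0 : φ ≠ 0) : Even m := by
  obtain ⟨g, hg⟩ : ∃ g, φ g ≠ 0 := Function.ne_iff.1 h0
  have h1 : (-1 : ℂ) ^ m * φ g = φ g := by rw [← hφ.apply_mul_rotK_pi g, hpos g]
  have h2 : (-1 : ℂ) ^ m = 1 := by
    have h3 : ((-1 : ℂ) ^ m - 1) * φ g = 0 := by linear_combination h1
    have h4 : (-1 : ℂ) ^ m - 1 = 0 := (mul_eq_zero.1 h3).resolve_right hg
    linear_combination h4
  rcases Int.even_or_odd m with he | ho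
  · exact he
  · rw [ho.neg_one_zpow] at h2
    norm_num at h2

/-- **A non-zero `SO(2)`-finite vector on which `-1` acts trivially, in a stable space where
`Ω = c` with `2c - m² + 2m ≠ 0` for even `m`, yields a non-zero vector of weight `0`** — the
vector-level form of "`π_∞` is an even principal series with a spherical vector" (parameter
`{a, -a}`, `c = 2a² - 1/2`). [cite: Bump1997, §2.5] [cite: JacquetLanglands1970, Thm. 5.11] -/
theorem exists_isWeightVec_zero_of_finite_of_even {W₁ : Submodule ℂ (G → ℂ)}
    (hsmooth : ∀ φ ∈ W₁, IsArchSmooth ι φ)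
    (heps : ∀ φ ∈ W₁, archTranslate ι epsK φ ∈ W₁)
    (hlie : ∀ (X : Matrix (Fin 2) (Fin 2) ℝ), ∀ φ ∈ W₁, lieDeriv ι (toLie X) φ ∈ W₁)
    {c : ℂ} (hcas : ∀ φ ∈ W₁, casimirFun ι φ = c • φ)
    (hc : ∀ k : ℤ, 2 * c - (2 * (k : ℂ)) ^ 2 + 2 * (2 * (k : ℂ)) ≠ 0)
    (hpos : ∀ φ ∈ W₁, ∀ g, φ (g * ι (rotK Real.pi)) = φ g)
    {φ : G → ℂ} (hφ0 : φ ≠ 0)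
    (hfin : ∃ V : Submodule ℂ (G → ℂ), FiniteDimensional ℂ V ∧ φ ∈ V ∧ V ≤ W₁ ∧
      ∀ θ : ℝ, ∀ ψ ∈ V, archTranslate ι (rotK θ) ψ ∈ V) :
    ∃ ψ ∈ W₁, ψ ≠ 0 ∧ IsWeightVec ι 0 ψ := by
  obtain ⟨V, hVfd, hφV, hVW, hVrot⟩ := hfin
  haveI := hVfd
  have hV : V ≠ ⊥ := fun h => hφ0 (by rw [h] at hφV; exact (Submodule.mem_bot ℂ).1 hφV)
  obtain ⟨m, v, hvV, hv0, hv⟩ :=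
    exists_isWeightVec_mem_of_finiteDimensional hV hVrot fun ψ hψ => hsmooth ψ (hVW hψ)
  obtain ⟨k, rfl⟩ := even_of_isWeightVec_of_rotK_pi hv (hpos v (hVW hvV)) hv0
  have hv' : IsWeightVec ι (2 * k) v := by rw [two_mul]; exact hv
  exact exists_isWeightVec_zero_of_even hsmooth heps hlie hcas hc (hVW hvV) hv0 hv'

/-- For `c = 2a² - 1/2` with `a ∈ ℤ`: `2c - (2k)² + 4k = 4a² - (2k - 1)² ≠ 0` (odd versus even).
[folklore] -/
theorem two_mul_casimir_sub_ne_zero (a k : ℤ) :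
    2 * (((2 * (a : ℝ) ^ 2 - 1 / 2 : ℝ)) : ℂ) - (2 * (k : ℂ)) ^ 2 + 2 * (2 * (k : ℂ)) ≠ 0 := by
  intro h
  have h' : ((4 * a ^ 2 - (2 * k - 1) ^ 2 : ℤ) : ℂ) = 0 := by
    push_cast at h ⊢
    linear_combination h
  have h'' : (4 * a ^ 2 - (2 * k - 1) ^ 2 : ℤ) = 0 := by exact_mod_cast h'
  have hodd : Odd ((2 * k - 1) ^ 2) := by
    have : Odd (2 * k - 1) := ⟨k - 1, by ring⟩
    exact this.pow
  have heven : Even (4 * a ^ 2) := ⟨2 * a ^ 2, by ring⟩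
  have : Even ((2 * k - 1) ^ 2) := by
    have e : (2 * k - 1) ^ 2 = 4 * a ^ 2 := by linarith
    rw [e]; exact heven
  exact (Int.not_even_iff_odd.mpr hodd) this

/-- **Registered sub-goal `stub_glue_evenLadder`** (the even ladder along `ι_𝔸 : GL₂(ℝ) → GL₂(𝔸_ℚ)`,
closed form of `exists_isWeightVec_zero_of_finite_of_even` for the glue stub of line `Sketch`).
[cite: Bump1997, §2.5] -/
theorem stub_glue_evenLadder : ∀ (W₁ : Submodule ℂ ((AdelicGroupData.gl 2 ℚ).Adelic → ℂ)) (c : ℂ), (∀ φ ∈ W₁, IsArchSmooth Rat.iotaA φ) → (∀ φ ∈ W₁, archTranslate Rat.iotaA epsK φ ∈ W₁) → (∀ (X : Matrix (Fin 2) (Fin 2) ℝ), ∀ φ ∈ W₁, lieDeriv Rat.iotaA (toLie X) φ ∈ W₁) → (∀ φ ∈ W₁, casimirFun Rat.iotaA φ = c • φ) → (∀ k : ℤ, 2 * c - (2 * (k : ℂ)) ^ 2 + 2 * (2 * (k : ℂ)) ≠ 0) → (∀ φ ∈ W₁, ∀ g, φ (g * Rat.iotaA (rotK Real.pi)) = φ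 g) → ∀ φ : (AdelicGroupData.gl 2 ℚ).Adelic → ℂ, φ ≠ 0 → (∃ V : Submodule ℂ ((AdelicGroupData.gl 2 ℚ).Adelic → ℂ), FiniteDimensional ℂ V ∧ φ ∈ V ∧ V ≤ W₁ ∧ ∀ θ : ℝ, ∀ ψ ∈ V, archTranslate Rat.iotaA (rotK θ) ψ ∈ V) → ∃ ψ ∈ W₁, ψ ≠ 0 ∧ IsWeightVec Rat.iotaA 0 ψ :=
  fun _ _ hsmooth heps hlie hcas hc hpos _ hφ0 hfin =>
    exists_isWeightVec_zero_of_finite_of_even hsmooth heps hlie hcas hc hpos hφ0 hfin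

end Summit.Langlands.Langlands.Theorems.CorrespondentFingerprint

end
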